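import Mathlib
import HarnessLib
import Summits.Langlands.Langlands.Theorems.RegularTwistCM.Negative.ArchShadow

/-!
# `RegularTwistCM` (stmt-Langlands-14069) — archimedean shadow II: CM parity and the global-power
normalisation (negative lane, `--supports`)

Sorry-free lemmas from §5 of the standing disprover's workfile
`Summits/Langlands/Langlands/Cruxes/RegularTwistCM/Disproof.lean` (cycle 2), landed so that ideators,
planners and the lead may import them. They sharpen what the crux consumes at `∞`:

* `complexPlace_twist_exists_free` — at ONE complex place a regular C-algebraic twist exists with NO
  relation between the exponent differences `a = s₁-s₂`, `b = t₁-t₂` (no purity, no unitarity), for every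
  choice of the two free integers; the modulus exponent is `n + 1 - Σ/2 - (a+b)/2`.
* `cmParity_obstructed` / `cmParity_sufficient` — globally (quartic CM field, `K⁺ = ℚ(√2)`) the
  algebraic part `∏_w u_w^{n_w - (a_w+b_w)/2}` of the unit condition can be made trivial on a
  finite-index subgroup iff all `a_w + b_w` have the SAME PARITY; this parity (implied by `b_w = ±a_w`,
  sign irrelevant) is the exact archimedean input any proof must import — for cuspidal `σ₀` it comes
  from local unitarity up to twist.
* `unitCondition_trivial_of_finite` — unit rank `0` (imaginary quadratic `K`): no condition at all.
* `noGlobalExponent_of_maassType` — a Maass-type central character with non-constant `t_w` defeats the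
  normalisation "`χ = |·|^s · χ_alg` for one global `s`".

None of these asserts a Theses statement; they are helper / tightness lemmas (NEGATIVE LEMMAS rule).
References: S. Patrikis, *Variations on a theorem of Tate*, Mem. AMS 258 (2019), no. 1238
(arXiv:1207.6724): Prop. 1.3.1, Prop. 1.3.3, Lemma 2.1.5, Def. 2.1.7, Cor. 2.1.8; A. Weil, *On a
certain type of characters of the idèle-class group* (1956).
-/

namespace Summit.Langlands.Langlands.Theorems.RegularTwistCM.Negative

open scoped BigOperators

/-- LOCAL TWIST AT A COMPLEX PLACE, PURITY-FREE, WITH THE INTEGER FREEDOM EXPLICIT: for a principal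
series `PS(z^{s₁}z̄^{t₁}, z^{s₂}z̄^{t₂})` with `s₁ - t₁ ∈ ℤ`, `s₂ = s₁ - a`, `t₂ = t₁ - b` (`a, b ∈ ℤ`
independent) and ANY integers `m, m'`, the character `χ_w = z^{1/2-s₁+m} z̄^{1/2-t₁+m'}` of `ℂ^×`
(`u - v ∈ ℤ`) puts all four exponents in `1/2 + ℤ`, regular when `a ≠ 0`, `b ≠ 0`, with modulus exponent
`u + v = (m+m') + 1 - Σ_w/2 - (a+b)/2`, `Σ_w = s₁+s₂+t₁+t₂`. [folklore] -/
theorem complexPlace_twist_exists_free (s₁ t₁ : ℂ) (a b m m' : ℤ) (hst : ∃ k : ℤ, s₁ - t₁ = k) :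
    ∃ u v : ℂ, (∃ k : ℤ, u - v = k) ∧
      (∃ k : ℤ, s₁ + u = k + 1 / 2) ∧ (∃ k : ℤ, (s₁ - a) + u = k + 1 / 2) ∧
      (∃ l : ℤ, t₁ + v = l + 1 / 2) ∧ (∃ l : ℤ, (t₁ - b) + v = l + 1 / 2) ∧
      (a ≠ 0 → s₁ + u ≠ (s₁ - a) + u) ∧ (b ≠ 0 → t₁ + v ≠ (t₁ - b) + v) ∧
      u + v = ((m + m' : ℤ) : ℂ) + 1 - (s₁ + (s₁ - a) + t₁ + (t₁ - b)) / 2 - ((a : ℂ) + b) / 2 := by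
  obtain ⟨k, hk⟩ := hst
  refine ⟨1 / 2 - s₁ + m, 1 / 2 - t₁ + m', ⟨m - m' - k, ?_⟩, ⟨m, ?_⟩, ⟨m - a, ?_⟩, ⟨m', ?_⟩,
    ⟨m' - b, ?_⟩, ?_, ?_, ?_⟩
  · push_cast; linear_combination -hk
  · ring
  · push_cast; ring
  · ring
  · push_cast; ring
  · intro ha h
    apply ha
    have : (a : ℂ) = 0 := by linear_combination h
    exact_mod_cast this
  · intro hb h
    apply hb
    have : (b : ℂ) = 0 := by linear_combination h
    exact_mod_cast this
  · push_cast; ring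

/-- THE CM-PARITY OBSTRUCTION (the CM transplant of Patrikis's totally-real obstruction): over a quartic
CM field with `K⁺ = ℚ(√2)` (totally positive unit `3+2√2 ↦ (3+2√2, 3-2√2)` at the two complex places),
if `a₁+b₁` and `a₂+b₂` have DIFFERENT parity then for NO integer shifts `n₁, n₂` and no common real
part `c` is the modulus `∏_w u_w^{c + n_w - (a_w+b_w)/2}` trivial on a finite-index subgroup
`(3+2√2)^{Nℤ}` — no Hecke character with the locally required exponents exists. For cuspidal `σ₀` this
never bites (`a_w + b_w = 0`), which is exactly the input a proof of the crux must import.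
[cite: Patrikis2019, Prop. 1.3.3 and Lemma 2.1.5] -/
theorem cmParity_obstructed (c : ℝ) (a₁ b₁ a₂ b₂ : ℤ) (hodd : Odd (a₁ + b₁ - (a₂ + b₂))) :
    ¬ ∃ n₁ n₂ : ℤ, ∃ N : ℕ, N ≠ 0 ∧
      ((3 + 2 * Real.sqrt 2) ^ (c + n₁ - ((a₁ : ℝ) + b₁) / 2) *
        (3 - 2 * Real.sqrt 2) ^ (c + n₂ - ((a₂ : ℝ) + b₂) / 2)) ^ N = 1 := by
  rintro ⟨n₁, n₂, N, hN, h⟩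
  have hx : (0 : ℝ) < 3 + 2 * Real.sqrt 2 := by positivity
  have hx1 : (3 + 2 * Real.sqrt 2 : ℝ) ≠ 1 := by
    have : (0 : ℝ) ≤ Real.sqrt 2 := Real.sqrt_nonneg 2
    intro h
    linarith
  rw [sqrt2_unit_inv] at h
  have hpar := parallel_of_unit_condition_finiteIndex hx hx1 _ _ hN h
  obtain ⟨r, hr⟩ := hodd
  have h2 : ((a₁ + b₁ - (a₂ + b₂) : ℤ) : ℝ) = ((2 * (n₁ - n₂) : ℤ) : ℝ) := by
    push_cast
    linarith
  have h3 : (a₁ + b₁ - (a₂ + b₂) : ℤ) = 2 * (n₁ - n₂) := by exact_mod_cast h2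
  omega

/-- CM-PARITY SUFFICES for the algebraic half of the unit condition: if all `a_w + b_w` are
`≡ c (mod 2)` then integer shifts `n_w` exist making `n_w - (a_w+b_w)/2` place-independent (so that
`∏_w u_w^{n_w - (a_w+b_w)/2} = N(u)^{const} = 1` on units of norm `1`). [folklore] -/
theorem cmParity_sufficient {ι : Type*} (a b : ι → ℤ) (c : ℤ)
    (h : ∀ w, ∃ r : ℤ, a w + b w = c + 2 * r) :
    ∃ n : ι → ℤ, ∀ w w', (n w : ℝ) - ((a w : ℝ) + b w) / 2 = n w' - ((a w' : ℝ) + b w') / 2 := by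
  choose r hr using h
  refine ⟨r, fun w w' => ?_⟩
  have hw : ((a w : ℝ) + b w) = c + 2 * r w := by exact_mod_cast hr w
  have hw' : ((a w' : ℝ) + b w') = c + 2 * r w' := by exact_mod_cast hr w'
  rw [hw, hw']
  ring

/-- UNIT RANK ZERO: over an imaginary quadratic field the global units form a FINITE group, so Weil's
criterion is automatic — every character of the units is killed on the finite-index subgroup `{1}`.
[folklore] -/
theorem unitCondition_trivial_of_finite {U : Type*} [Group U] [Finite U] (f : U →* ℂˣ) :
    ∃ H : Subgroup U, H.FiniteIndex ∧ ∀ u ∈ H, f u = 1 := by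
  refine ⟨⊥, ?_, fun u hu => ?_⟩
  · infer_instance
  · rw [Subgroup.mem_bot] at hu
    simp [hu]

/-- MAASS-TYPE CENTRAL CHARACTERS DEFEAT A GLOBAL `|·|^s` NORMALISATION: if the modulus exponents
required at two complex places are `c - 2it₁ + ℝ` and `c - 2it₂ + ℝ` (the real summands being what an
algebraic, finite-order or real-power character can contribute) and `t₁ ≠ t₂`, then no single complex
`s` serves both places. [cite: Patrikis2019, Def. 2.1.7 and Cor. 2.1.8] -/
theorem noGlobalExponent_of_maassType (c : ℂ) (t₁ t₂ : ℝ) (ht : t₁ ≠ t₂) :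
    ¬ ∃ (s : ℂ) (r₁ r₂ : ℝ), s + r₁ = c - 2 * Complex.I * t₁ ∧ s + r₂ = c - 2 * Complex.I * t₂ := by
  rintro ⟨s, r₁, r₂, h₁, h₂⟩
  have h : ((r₁ : ℂ) - r₂) = -(2 * Complex.I * t₁) + 2 * Complex.I * t₂ := by
    linear_combination h₁ - h₂
  have him := congrArg Complex.im h
  simp at him
  apply ht
  linarith

end Summit.Langlands.Langlands.Theorems.RegularTwistCM.Negative
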